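import Summits.ResolutionOfSingularities.ResolutionOfSingularities.Theorems.HomologicalConductorNoZenoSplitExcCount
import Summits.ResolutionOfSingularities.ResolutionOfSingularities.Theorems.HomologicalConductorNoZenoThreadCount
import Literature.AlgebraicGeometry.Resolution.RationalSurfaceSingularitiesBasic
import Literature.AlgebraicGeometry.Resolution.ExceptionalPointsFinite
import Literature.AlgebraicGeometry.Resolution.ExceptionalCurvePoints
import HarnessLib

/-!
# Crux `NoZenoR` / `NoZeno` (stmt-ResolutionOfSingularities-19943 / -16483), β layer, (R-w) slots:
# (L0)-w + (∃N)-w — SPLIT exceptional count zero ⇔ regular; rational germs have a finite split count; thread germs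

Route `ResolutionOfSingularities/HomologicalConductor`.  OURS (cell res-hironaka, chain W4.4, planner res-L0-w44-plan-1
(ρ20) «THREAD-COUNT-w»); nothing here is a statement of the manuscript under review.  The split-count TWINS, by
signature, of `…NoZenoThreadCount` (p525433, res-L0-w44-stub-2) over U8's measure `ExcCount.HasSplitExcCurveCountLE`
(`…NoZenoSplitExcCount`, res-L0-w44-stub-2: `N^s(R) ≤ N`, the exceptional curves of a minimal resolution counted
with their separable splitting weights `splitWeight ≥ 1`), i.e. the slot theorems `Sig.L0 HasSplitExcCurveCountLE` /
`Sig.ExN HasSplitExcCurveCountLE` of the measure-generic β2 descent (v24-draft) one `intro` away: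

* (L0)-w `isRegularLocalRing_of_hasSplitExcCurveCountLE_zero`, `hasSplitExcCurveCountLE_zero_iff` — for a
  two-dimensional normal Noetherian local domain, split count `0` ⇔ regular (U8's comparison
  `hasExcCurveCountLE_of_hasSplitExcCurveCountLE` «`N ≤ N^s`» + p525433's (L0) + U8's
  `hasSplitExcCurveCountLE_zero_of_isRegularLocalRing`); `not_hasSplitExcCurveCountLE_zero_of_thread` — no germ of
  a tr.deg-3 singular prime thread has split count `0` (T-GERM).
* (∃N)-w `exists_hasSplitExcCurveCountLE_of_hasRationalSingularity`, `exists_hasSplitExcCurveCountLE_threadGerm`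
  (mod the named fact `Lipman1969_4_1`: the minimal resolution of a rational germ exists; its integral exceptional
  curves are finitely many by `excPoints_finite`, so `N := splitExcCount` of it bounds itself).

References: J. Lipman, Publ. Math. IHÉS 36 (1969), (4.1) p. 204, §10 p. 212 [`Lipman1969`].  AI-written; weaker
than expert review.
-/

noncomputable section

-- single-problem summit: the doubled namespace component `ResolutionOfSingularities` is forced
set_option linter.dupNamespace false

namespace Summit.ResolutionOfSingularities.ResolutionOfSingularities.Theorems.NoZeno.SandwichCluster.Thread

open IsLocalRing AlgebraicGeometry
open Summit.ResolutionOfSingularities.ResolutionOfSingularities.Theses.HomologicalConductor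
open Summit.ResolutionOfSingularities.ResolutionOfSingularities.Theorems.NoZeno.Birth
open Summit.ResolutionOfSingularities.ResolutionOfSingularities.Theorems.NoZeno.ExcCount (HasExcCurveCountLE
  splitExcCount HasSplitExcCurveCountLE hasSplitExcCurveCountLE_zero_of_isRegularLocalRing
  hasExcCurveCountLE_of_hasSplitExcCurveCountLE)
open Literature.AlgebraicGeometry.Resolution

variable {k K : Type} [Field k] [Field K] [Algebra k K]

/-! ## (w1) = (L0)-w: split count zero ⇔ regular -/

/-- **(L0)-w: split count zero ⇒ regular** for a two-dimensional normal Noetherian local domain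
(`isRegularLocalRing_of_hasExcCurveCountLE_zero` after `N ≤ N^s`). [this work] -/
theorem isRegularLocalRing_of_hasSplitExcCurveCountLE_zero {R : Type} [CommRing R] [IsNoetherianRing R]
    [IsDomain R] [IsLocalRing R] [IsIntegrallyClosed R] (h2 : ringKrullDim R = 2)
    (h : HasSplitExcCurveCountLE R 0) : IsRegularLocalRing R :=
  isRegularLocalRing_of_hasExcCurveCountLE_zero h2 (hasExcCurveCountLE_of_hasSplitExcCurveCountLE h)

/-- **Split count zero ⇔ regular** for two-dimensional normal Noetherian local domains (with U8's
`hasSplitExcCurveCountLE_zero_of_isRegularLocalRing`). [this work] -/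
theorem hasSplitExcCurveCountLE_zero_iff {R : Type} [CommRing R] [IsNoetherianRing R] [IsDomain R]
    [IsLocalRing R] [IsIntegrallyClosed R] (h2 : ringKrullDim R = 2) :
    HasSplitExcCurveCountLE R 0 ↔ IsRegularLocalRing R :=
  ⟨isRegularLocalRing_of_hasSplitExcCurveCountLE_zero h2, fun h => by
    haveI := h; exact hasSplitExcCurveCountLE_zero_of_isRegularLocalRing R⟩

/-- **Along a thread no germ has split count zero**: the germ `D = (T_(n+1))_P` of a tr.deg-3 singular prime thread
is a two-dimensional normal SINGULAR local domain (T-GERM, via `not_hasExcCurveCountLE_zero_of_thread` and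
`N ≤ N^s`). [this work] -/
theorem not_hasSplitExcCurveCountLE_zero_of_thread (O : ValuationSubring K) (A : Subalgebra k K)
    (hk : ∀ c : k, algebraMap k K c ∈ O) (hA : A.FG) (hfr : IsFractionRing ↥A K)
    (hAO : A.toSubring ≤ O.toSubring) (htr : Algebra.trdeg k K = 3) (n : ℕ)
    (P : Ideal ↥(tower O A (n + 1))) (hP : P.IsPrime)
    (hca : ∀ (x : K) (hx : x ∈ tower O A (n + 1)), x ∈ ca (tower O A (n + 1)) →
      (⟨x, hx⟩ : ↥(tower O A (n + 1))) ∈ P)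
    (hs : ∃ (s : K) (hs : s ∈ tower O A (n + 1)), O.valuation s < 1 ∧
      (⟨s, hs⟩ : ↥(tower O A (n + 1))) ∉ P) :
    ¬ @HasSplitExcCurveCountLE ↥(Parasite.locPrime (tower O A (n + 1)) P hP) _
      (Parasite.isLocalRing_locPrime _ _ _) 0 := by
  intro h0
  haveI : IsLocalRing ↥(Parasite.locPrime (tower O A (n + 1)) P hP) := Parasite.isLocalRing_locPrime _ _ _
  exact not_hasExcCurveCountLE_zero_of_thread O A hk hA hfr hAO htr n P hP hca hs
    (hasExcCurveCountLE_of_hasSplitExcCurveCountLE h0)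

/-! ## (w2) = (∃N)-w: rational germs have a finite split count (mod Lipman (4.1)) -/

/-- **(∃N)-w** A two-dimensional normal Noetherian local domain with a RATIONAL singularity has some finite split
count `N^s(R) ≤ N`: the minimal resolution exists (Lipman (4.1), `Lipman1969_4_1.exists_isMinimalResolution_Spec`)
and its integral exceptional curves are finitely many (`excPoints_finite`, `excCurvePoints_subset_excPoints`).
[cite: Lipman1969, Theorem (4.1) (p. 204)] -/
theorem exists_hasSplitExcCurveCountLE_of_hasRationalSingularity (h41 : Lipman1969_4_1.{0}) {R : Type}
    [CommRing R] [IsNoetherianRing R] [IsLocalRing R] [IsDomain R] [IsIntegrallyClosed R]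
    (hdim : ringKrullDim R = 2) (hrat : HasRationalSingularity R) : ∃ N : ℕ, HasSplitExcCurveCountLE R N := by
  obtain ⟨X, f, hf⟩ := h41.exists_isMinimalResolution_Spec R hdim hrat
  haveI : IsProper f := hf.isResolution.isProper
  have hfin : (excCurvePoints f).Finite :=
    (excPoints_finite f).subset (hf.isResolution.excCurvePoints_subset_excPoints hdim)
  exact ⟨splitExcCount f, X, f, hf, hfin, le_rfl⟩

/-- **β2b-w by name for the thread germs** (mod `Lipman1969_4_1`): a RATIONAL germ `D = (T_(n+1))_P` of a tr.deg-3
singular prime thread has some finite split count. [this work] -/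
theorem exists_hasSplitExcCurveCountLE_threadGerm (h41 : Lipman1969_4_1.{0}) (O : ValuationSubring K)
    (A : Subalgebra k K) (hk : ∀ c : k, algebraMap k K c ∈ O) (hA : A.FG) (hfr : IsFractionRing ↥A K)
    (hAO : A.toSubring ≤ O.toSubring) (htr : Algebra.trdeg k K = 3) (n : ℕ)
    (P : Ideal ↥(tower O A (n + 1))) (hP : P.IsPrime)
    (hca : ∀ (x : K) (hx : x ∈ tower O A (n + 1)), x ∈ ca (tower O A (n + 1)) →
      (⟨x, hx⟩ : ↥(tower O A (n + 1))) ∈ P)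
    (hs : ∃ (s : K) (hs : s ∈ tower O A (n + 1)), O.valuation s < 1 ∧
      (⟨s, hs⟩ : ↥(tower O A (n + 1))) ∉ P)
    (hrat : HasRationalSingularity ↥(Parasite.locPrime (tower O A (n + 1)) P hP)) :
    ∃ N : ℕ, @HasSplitExcCurveCountLE ↥(Parasite.locPrime (tower O A (n + 1)) P hP) _
      (Parasite.isLocalRing_locPrime _ _ _) N := by
  haveI := hP
  haveI := hfr
  obtain ⟨hdim, hIC, -⟩ := threadGerm_of_trdeg O A hk hA hfr hAO htr n P hP hca hs
  haveI : IsNoetherianRing ↥(tower O A (n + 1)) := stub_towerNoetherian k K O A hk hA hfr hAO (n + 1)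
  letI : Algebra ↥(tower O A (n + 1)) ↥(Parasite.locPrime (tower O A (n + 1)) P hP) :=
    (Subring.inclusion (toSubring_le_locPrime (tower O A (n + 1)) P hP)).toAlgebra
  haveI := isLocalization_locPrime (tower O A (n + 1)) P hP
  haveI : IsNoetherianRing ↥(Parasite.locPrime (tower O A (n + 1)) P hP) :=
    IsLocalization.isNoetherianRing P.primeCompl _ inferInstance
  haveI : IsLocalRing ↥(Parasite.locPrime (tower O A (n + 1)) P hP) := Parasite.isLocalRing_locPrime _ _ _
  haveI := hIC
  exact exists_hasSplitExcCurveCountLE_of_hasRationalSingularity h41 hdim hrat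

end Summit.ResolutionOfSingularities.ResolutionOfSingularities.Theorems.NoZeno.SandwichCluster.Thread

end
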